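import Mathlib
import HarnessLib
import Literature.Analysis.FluidPDE.ESSLocalHolderHolds
import Summits.NavierStokesRegularity.NavierStokesRegularity.Theses.TypeIQuarterGate
import Summits.NavierStokesRegularity.NavierStokesRegularity.Theorems.TypeIQuarterGateScarZoomDefs
import Summits.NavierStokesRegularity.NavierStokesRegularity.Theorems.TypeIQuarterGateSliceBudgetDefs
import Summits.NavierStokesRegularity.NavierStokesRegularity.Theorems.TypeIQuarterGateScarEnvelopeTypeIBlowupIsCompact
import Summits.NavierStokesRegularity.NavierStokesRegularity.Theorems.TypeIQuarterGateScarEnvelopeTypeIViolatorsApproachScar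
import Summits.NavierStokesRegularity.NavierStokesRegularity.Theorems.TypeIQuarterGateScarEnvelopeTypeITameScarZoom

/-!
# Line `slice_budget` on crux `TypeIQuarterGate.ScarEnvelopeTypeI` (stmt-NavierStokesRegularity-23843) —
# REDUCTION: the crux is EQUIVALENT to its deciding stub SD (the slice-wise octave budget)

With STUB 0 (`ScarZoom.stub_blowupIsCompact`, p611204), STUB A (`ScarZoom.stub_violatorsApproachScar`,
p607379) and STUB B (`SliceBudget.stub_tameScarZoom`) landed, the line `slice_budget` pins the crux
EXACTLY on its deciding stub: the statement of SD `stub_sliceOctaveBudget`,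

  `∀ ν T u p, CruxHypotheses ν T u p → TameOutside T u → OctaveBudget ν T u`,

is EQUIVALENT to the crux `TypeIQuarterGate.ScarEnvelopeTypeI` (`scarEnvelopeTypeI_iff_sliceOctaveBudget`).
* (⇒, the skeleton) violators of the envelope at a scar of a tame Type-I blow-up carrying the budget
  zoom to a tame twin-scar object, which ESS 2003 Thm 1.4 forbids (`noTameTwinScar`, the line owner
  ns-idea-7's proof from `Cruxes/ScarEnvelopeTypeI/Lines/slice_budget.lean`, copied verbatim so that a
  Theorems module carries it).
* (⇐, elementary, `octaveBudget_of_envelope`) the envelope `|u| ≤ C' + Σ_{b∈σ} C'/(|x−b|+√(T−t))`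
  bounds `|u(t)|` on an e-annulus `{ℓ < |y−a| < eℓ}`, `0 < ℓ ≤ r₀`, `e r₀ ≤ d/2` (`d` = the distance from
  `a` to the other points of `σ`), by `|C'|(1 + 2#σ/d) + #σ|C'|/ℓ`, whence the annular cube is at most
  `(e(K r₀ + #σ|C'|))³ · |B₁|` — the octave budget with `δ = T` (no singularity hypothesis and no
  parabolic admissibility are needed for this direction).

So after this line's work 23843 is neither weaker nor stronger than SD: the «no satellites» content
of the crux IS the slice-wise cube budget at the scars.  SD stays OPEN (instrument-first, director
KEY-NS #87 (3)); no statement about the crux, its parent `QuarterLawTypeI` or the summit is proved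
by this file — it proves an equivalence between two open statements and the implication from the
crux's conclusion to the budget.
-/

noncomputable section

-- the summit-side namespace `Summit.NavierStokesRegularity.NavierStokesRegularity.…` (single-conjunct
-- summit, D-0017) repeats a component by design; the dupNamespace linter would flag every declaration.
set_option linter.dupNamespace false

namespace Summit.NavierStokesRegularity.NavierStokesRegularity.Cruxes.ScarEnvelopeTypeI.SliceBudget

open MeasureTheory Set Function Filter Topology TopologicalSpace Metric
open scoped NNReal ENNReal
open Literature.Analysis Literature.Analysis.FluidPDE
open Summit.NavierStokesRegularity.NavierStokesRegularity.Cruxes.ScarEnvelopeTypeI.ScarZoom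
  (CruxHypotheses Envelope TameOutside ScarViolators SingularAt stub_blowupIsCompact
    stub_violatorsApproachScar)

/-! ### ESS kills the second scar (the line owner's proof, made importable) -/

/-- **NO TAME TWIN-SCAR OBJECT** (line `slice_budget`, ns-idea-7 g2; proof copied verbatim from the
skeleton `Cruxes/ScarEnvelopeTypeI/Lines/slice_budget.lean`, where it is `noTameTwinScar`).  ESS
Thm 1.4 (`ess_local_holder_holds`) makes the normalised translate `w` Hölder continuous on the
closure of `Q(1/2)`, a.e. equal to `w`; `w` is continuous on the open cylinder (the KNSS gauge is
jointly smooth on the open past), so the two agree everywhere on `Q(1/2)` and `w` is bounded there;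
undoing the normalisation bounds `v` on `(−1/16, 0) × B(e, 1/4)`, contradicting `SingularAt v e`. -/
theorem noTameTwinScar' (M : ℝ) (v : ℝ → EuclideanSpace ℝ (Fin 3) → EuclideanSpace ℝ (Fin 3)) :
    ¬ TameTwinScar M v := by
  rintro ⟨hv, -, e, -, hsing, π, hns, hL2, hgrad, hπ, hL3⟩
  obtain ⟨w, C, α, hα, hHolder, hae⟩ :=
    Literature.Analysis.FluidPDE.ess_local_holder_holds (essTranslate v e) π hns hL2 hgrad hπ hL3
  set Q : Set (ℝ × EuclideanSpace ℝ (Fin 3)) :=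
    Literature.Analysis.FluidPDE.parabolicCylinder (1 / 2) ((0 : ℝ), (0 : EuclideanSpace ℝ (Fin 3)))
    with hQdef
  have hQopen : IsOpen Q := Literature.Analysis.FluidPDE.isOpen_parabolicCylinder _ _
  have hmemQ : ∀ z : ℝ × EuclideanSpace ℝ (Fin 3),
      z ∈ Q ↔ (-(1 / 4 : ℝ) < z.1 ∧ z.1 < 0) ∧ ‖z.2‖ < 1 / 2 := by
    intro z
    simp only [hQdef, Literature.Analysis.FluidPDE.parabolicCylinder, Set.mem_prod, Set.mem_Ioo,
      Metric.mem_ball, dist_zero_right]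
    norm_num
  -- continuity of the normalised translate on the open cylinder
  have hφ : Continuous fun z : ℝ × EuclideanSpace ℝ (Fin 3) => (z.1 / 4, e + (1 / 2 : ℝ) • z.2) := by
    fun_prop
  have hmaps : Set.MapsTo (fun z : ℝ × EuclideanSpace ℝ (Fin 3) => (z.1 / 4, e + (1 / 2 : ℝ) • z.2)) Q
      (Set.Iio (0 : ℝ) ×ˢ (Set.univ : Set (EuclideanSpace ℝ (Fin 3)))) := by
    intro z hz
    refine ⟨?_, Set.mem_univ _⟩
    have h := ((hmemQ z).1 hz).1.2
    show z.1 / 4 < 0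
    linarith
  have hcomp : ContinuousOn
      (fun z : ℝ × EuclideanSpace ℝ (Fin 3) => Function.uncurry v (z.1 / 4, e + (1 / 2 : ℝ) • z.2)) Q :=
    hv.continuousOn_uncurry.comp hφ.continuousOn hmaps
  have hcont : ContinuousOn (Function.uncurry (essTranslate v e)) Q := by
    have : Function.uncurry (essTranslate v e) =
        fun z : ℝ × EuclideanSpace ℝ (Fin 3) =>
          (1 / 2 : ℝ) • Function.uncurry v (z.1 / 4, e + (1 / 2 : ℝ) • z.2) := by
      funext z; rfl
    rw [this]
    exact hcomp.const_smul (1 / 2 : ℝ)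
  have hwcont : ContinuousOn w Q := (hHolder.continuousOn hα).mono subset_closure
  have heq : Set.EqOn (Function.uncurry (essTranslate v e)) w Q :=
    Measure.eqOn_open_of_ae_eq hae hQopen hcont hwcont
  -- a bound for `w` on `Q` from the Hölder seminorm
  set z₀ : ℝ × EuclideanSpace ℝ (Fin 3) := ((-(1 / 8) : ℝ), (0 : EuclideanSpace ℝ (Fin 3))) with hz₀def
  have hz₀ : z₀ ∈ Q := by
    rw [hmemQ, hz₀def]
    norm_num
  have hbound : ∀ z ∈ Q, ‖w z‖ ≤ ‖w z₀‖ + C := by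
    intro z hz
    have hzQ := (hmemQ z).1 hz
    have hd : dist z z₀ ≤ 1 := by
      rw [Prod.dist_eq]
      refine max_le ?_ ?_
      · rw [Real.dist_eq]
        have h1 := hzQ.1.1
        have h2 := hzQ.1.2
        have e0 : z₀.1 = -(1 / 8 : ℝ) := rfl
        rw [abs_le, e0]
        exact ⟨by linarith, by linarith⟩
      · rw [dist_eq_norm]
        simp only [hz₀def, sub_zero]
        linarith [hzQ.2]
    have hdist : dist (w z) (w z₀) ≤ C * (1 : ℝ) ^ (α : ℝ) :=
      hHolder.dist_le_of_le (subset_closure hz) (subset_closure hz₀) hd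
    rw [Real.one_rpow, mul_one] at hdist
    calc ‖w z‖ ≤ ‖w z₀‖ + ‖w z - w z₀‖ := norm_le_insert' _ _
      _ = ‖w z₀‖ + dist (w z) (w z₀) := by rw [dist_eq_norm]
      _ ≤ ‖w z₀‖ + C := by linarith
  -- the singular point `e` contradicts the bound
  obtain ⟨t, ht, y, hy, hA⟩ := hsing (1 / 4) (by norm_num) (2 * (‖w z₀‖ + C))
  rw [Set.mem_Ioo] at ht
  rw [Metric.mem_ball, dist_eq_norm] at hy
  set z : ℝ × EuclideanSpace ℝ (Fin 3) := ((4 : ℝ) * t, (2 : ℝ) • (y - e)) with hzdef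
  have hz : z ∈ Q := by
    rw [hmemQ]
    refine ⟨⟨?_, ?_⟩, ?_⟩
    · show -(1 / 4 : ℝ) < 4 * t
      nlinarith [ht.1]
    · show (4 : ℝ) * t < 0
      linarith [ht.2]
    · show ‖(2 : ℝ) • (y - e)‖ < 1 / 2
      rw [norm_smul, Real.norm_eq_abs, abs_of_pos (by norm_num : (0 : ℝ) < 2)]
      linarith
  have hval : Function.uncurry (essTranslate v e) z = (1 / 2 : ℝ) • v t y := by
    show (1 / 2 : ℝ) • v ((4 : ℝ) * t / 4) (e + (1 / 2 : ℝ) • ((2 : ℝ) • (y - e))) =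
      (1 / 2 : ℝ) • v t y
    have h1 : (4 : ℝ) * t / 4 = t := by ring
    have h2 : e + (1 / 2 : ℝ) • ((2 : ℝ) • (y - e)) = y := by
      rw [smul_smul, show (1 / 2 : ℝ) * 2 = 1 by norm_num, one_smul, add_sub_cancel]
    rw [h1, h2]
  have hwz : ‖w z‖ ≤ ‖w z₀‖ + C := hbound z hz
  have hvy : ‖v t y‖ = 2 * ‖w z‖ := by
    rw [← heq hz, hval, norm_smul, Real.norm_eq_abs, abs_of_pos (by norm_num : (0 : ℝ) < 1 / 2)]
    ring
  linarith

/-! ### The envelope implies the octave budget -/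

/-- **The crux's conclusion implies the slice-wise octave budget** (elementary; this is the sense in
which the line's deciding stub SD is WEAKER than the crux).  If `0 < T` and
`|u(t, x)| ≤ C' + Σ_{b∈σ} C'/(|x − b| + √(T − t))` on `[0, T)`, then at EVERY point `a` (singular or
not), with `d ≤ |a − b|` for the points `b ≠ a` of `σ`, `r₀ = d/(2e)` and `δ = T`: on an e-annulus
`{ℓ < |y − a| < eℓ}`, `0 < ℓ ≤ r₀`, the envelope is at most `K + #σ|C'|/ℓ`, `K = |C'|(1 + 2#σ/d)`,
so the annular cube is at most `(e(K r₀ + #σ|C'|))³ |B₁|` (and an annulus with `ℓ ≤ 0` is empty). -/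
theorem octaveBudget_of_envelope {ν T : ℝ}
    {u : ℝ → EuclideanSpace ℝ (Fin 3) → EuclideanSpace ℝ (Fin 3)} (hT : 0 < T) (hEnv : Envelope T u) :
    OctaveBudget ν T u := by
  classical
  obtain ⟨σ, C', hE⟩ := hEnv
  intro a _
  -- separation of `a` from the other points of `σ`
  obtain ⟨d, hd, hsep⟩ : ∃ d : ℝ, 0 < d ∧ ∀ b ∈ σ, b ≠ a → d ≤ ‖a - b‖ := by
    by_cases hne : (σ.erase a).Nonempty
    · obtain ⟨b₀, hb₀, hmin⟩ := (σ.erase a).exists_min_image (fun b => ‖a - b‖) hne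
      refine ⟨‖a - b₀‖, norm_pos_iff.2 (sub_ne_zero.2 (Finset.ne_of_mem_erase hb₀).symm),
        fun b hb hba => hmin b (Finset.mem_erase.2 ⟨hba, hb⟩)⟩
    · exact ⟨1, one_pos, fun b hb hba => absurd ⟨b, Finset.mem_erase.2 ⟨hba, hb⟩⟩ hne⟩
  -- constants
  set n : ℝ := (σ.card : ℝ) with hn
  have hn0 : 0 ≤ n := by positivity
  set A : ℝ := |C'| with hAdef
  have hA0 : 0 ≤ A := abs_nonneg _
  set K : ℝ := A * (1 + 2 * n / d) with hK
  have hK0 : 0 ≤ K := by positivity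
  set r₀ : ℝ := d / (2 * Real.exp 1) with hr₀
  have hexp : 0 < Real.exp 1 := Real.exp_pos 1
  have hr₀pos : 0 < r₀ := by positivity
  set V : ℝ≥0∞ := volume (ball (0 : EuclideanSpace ℝ (Fin 3)) 1) with hV
  have hVtop : V ≠ ⊤ := measure_ball_lt_top.ne
  set q : ℝ := (Real.exp 1 * (K * r₀ + n * A)) ^ 3 * V.toReal with hq
  refine ⟨q, T, r₀, hT, hr₀pos, fun t ht ℓ _ hℓr₀ => ?_⟩
  rw [sub_self] at ht
  have htI : t ∈ Ico 0 T := ⟨ht.1.le, ht.2⟩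
  have hst : 0 < Real.sqrt (T - t) := Real.sqrt_pos.2 (by linarith [ht.2])
  set S : Set (EuclideanSpace ℝ (Fin 3)) :=
    {y : EuclideanSpace ℝ (Fin 3) | ℓ < ‖y - a‖ ∧ ‖y - a‖ < Real.exp 1 * ℓ} with hS
  -- an annulus with `ℓ ≤ 0` is empty
  by_cases hℓ : ℓ ≤ 0
  · have hSe : S = ∅ := by
      refine Set.eq_empty_iff_forall_notMem.2 fun y hy => ?_
      have h1 : ℓ < ‖y - a‖ := hy.1
      have h2 : ‖y - a‖ < Real.exp 1 * ℓ := hy.2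
      have h3 : Real.exp 1 * ℓ ≤ 0 := mul_nonpos_of_nonneg_of_nonpos hexp.le hℓ
      linarith [norm_nonneg (y - a)]
    rw [hSe, Measure.restrict_empty, lintegral_zero_measure]
    exact bot_le
  push Not at hℓ
  -- the pointwise envelope bound on the annulus
  have hpt : ∀ y ∈ S, ‖u t y‖ ≤ K + n * A / ℓ := by
    intro y hy
    have h1 : ℓ < ‖y - a‖ := hy.1
    have h2 : ‖y - a‖ < Real.exp 1 * ℓ := hy.2
    have hya : ‖y - a‖ < d / 2 := by
      have : Real.exp 1 * ℓ ≤ Real.exp 1 * r₀ := mul_le_mul_of_nonneg_left hℓr₀ hexp.le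
      have e2 : Real.exp 1 * r₀ = d / 2 := by
        rw [hr₀]; field_simp
      linarith
    -- each scar term is at most `A/ℓ + 2A/d`
    have hterm : ∀ b ∈ σ, C' / (‖y - b‖ + Real.sqrt (T - t)) ≤ A / ℓ + 2 * A / d := by
      intro b hb
      have hden : 0 < ‖y - b‖ + Real.sqrt (T - t) := by positivity
      have hle1 : C' / (‖y - b‖ + Real.sqrt (T - t)) ≤ A / (‖y - b‖ + Real.sqrt (T - t)) :=
        div_le_div_of_nonneg_right (le_abs_self C') hden.le
      refine hle1.trans ?_
      by_cases hba : b = a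
      · subst hba
        have h3 : A / (‖y - b‖ + Real.sqrt (T - t)) ≤ A / ℓ :=
          div_le_div_of_nonneg_left hA0 hℓ (by linarith)
        have h4 : 0 ≤ 2 * A / d := by positivity
        linarith
      · have hsep' : d ≤ ‖a - b‖ := hsep b hb hba
        have hyb : d / 2 ≤ ‖y - b‖ := by
          have h5 : ‖a - b‖ ≤ ‖y - a‖ + ‖y - b‖ := by
            calc ‖a - b‖ = ‖(a - y) + (y - b)‖ := by rw [sub_add_sub_cancel]
              _ ≤ ‖a - y‖ + ‖y - b‖ := norm_add_le _ _
              _ = ‖y - a‖ + ‖y - b‖ := by rw [norm_sub_rev a y]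
          linarith
        have h3 : A / (‖y - b‖ + Real.sqrt (T - t)) ≤ A / (d / 2) :=
          div_le_div_of_nonneg_left hA0 (by positivity) (by linarith)
        have h4 : A / (d / 2) = 2 * A / d := by field_simp
        have h5 : 0 ≤ A / ℓ := by positivity
        linarith
    have hsum : ∑ b ∈ σ, C' / (‖y - b‖ + Real.sqrt (T - t)) ≤ ∑ b ∈ σ, (A / ℓ + 2 * A / d) :=
      Finset.sum_le_sum hterm
    rw [Finset.sum_const, nsmul_eq_mul] at hsum
    calc ‖u t y‖ ≤ C' + ∑ b ∈ σ, C' / (‖y - b‖ + Real.sqrt (T - t)) := hE t htI y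
      _ ≤ A + n * (A / ℓ + 2 * A / d) := add_le_add (le_abs_self C') hsum
      _ = K + n * A / ℓ := by rw [hK]; ring
  -- integrate the cube of the bound over the annulus
  have hSmeas : MeasurableSet S :=
    ((isOpen_lt continuous_const (continuous_id.sub continuous_const).norm).inter
      (isOpen_lt (continuous_id.sub continuous_const).norm continuous_const)).measurableSet
  have hSball : S ⊆ ball a (Real.exp 1 * ℓ) := fun y hy => by
    rw [mem_ball, dist_eq_norm]; exact hy.2
  have hB0 : 0 ≤ K + n * A / ℓ := by positivity
  calc ∫⁻ y in S, ‖u t y‖ₑ ^ (3 : ℝ)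
      ≤ ∫⁻ y in S, ENNReal.ofReal ((K + n * A / ℓ) ^ 3) := by
        refine setLIntegral_mono' hSmeas fun y hy => ?_
        rw [← ofReal_norm, ENNReal.ofReal_rpow_of_nonneg (norm_nonneg _) (by norm_num),
          show ‖u t y‖ ^ (3 : ℝ) = ‖u t y‖ ^ (3 : ℕ) by exact_mod_cast Real.rpow_natCast ‖u t y‖ 3]
        exact ENNReal.ofReal_le_ofReal (pow_le_pow_left₀ (norm_nonneg _) (hpt y hy) 3)
    _ = ENNReal.ofReal ((K + n * A / ℓ) ^ 3) * volume S := setLIntegral_const _ _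
    _ ≤ ENNReal.ofReal ((K + n * A / ℓ) ^ 3) * volume (ball a (Real.exp 1 * ℓ)) :=
        mul_le_mul' le_rfl (measure_mono hSball)
    _ = ENNReal.ofReal ((K + n * A / ℓ) ^ 3) * (ENNReal.ofReal ((Real.exp 1 * ℓ) ^ 3) * V) := by
        rw [Measure.addHaar_ball_of_pos volume a (by positivity : 0 < Real.exp 1 * ℓ),
          finrank_euclideanSpace_fin]
    _ = ENNReal.ofReal ((Real.exp 1 * (K * ℓ + n * A)) ^ 3) * V := by
        rw [← mul_assoc, ← ENNReal.ofReal_mul (by positivity), ← mul_pow]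
        congr 3
        field_simp
    _ ≤ ENNReal.ofReal ((Real.exp 1 * (K * r₀ + n * A)) ^ 3) * V := by
        refine mul_le_mul' (ENNReal.ofReal_le_ofReal ?_) le_rfl
        have h1 : Real.exp 1 * (K * ℓ + n * A) ≤ Real.exp 1 * (K * r₀ + n * A) :=
          mul_le_mul_of_nonneg_left (by nlinarith [mul_le_mul_of_nonneg_left hℓr₀ hK0]) hexp.le
        exact pow_le_pow_left₀ (by positivity) h1 3
    _ = ENNReal.ofReal q := by
        rw [hq, ENNReal.ofReal_mul (by positivity), ENNReal.ofReal_toReal hVtop]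

/-! ### The reduction -/

/-- **REDUCTION: the crux `ScarEnvelopeTypeI` is EQUIVALENT to the deciding stub SD of line
`slice_budget`.**  (⇒ of the `Iff`, i.e. SD ⇒ crux) is the line's skeleton with the landed STUB 0,
STUB A, STUB B and `noTameTwinScar'`; (⇐) the crux's envelope implies the budget
(`octaveBudget_of_envelope`).  Both sides are OPEN; this theorem proves neither. -/
theorem scarEnvelopeTypeI_iff_sliceOctaveBudget :
    (∀ (ν T : ℝ) (u : ℝ → EuclideanSpace ℝ (Fin 3) → EuclideanSpace ℝ (Fin 3))
        (p : ℝ → EuclideanSpace ℝ (Fin 3) → ℝ),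
        CruxHypotheses ν T u p → TameOutside T u → OctaveBudget ν T u) ↔
      Summit.NavierStokesRegularity.NavierStokesRegularity.Theses.TypeIQuarterGate.ScarEnvelopeTypeI := by
  constructor
  · intro hD ν T hν hT u p hmax hLH hdec hTI hfin
    by_contra hEnv
    have H : CruxHypotheses ν T u p := ⟨hν, hT, hmax, hLH, hdec, hTI, hfin⟩
    have hTame : TameOutside T u := stub_blowupIsCompact ν T u p H
    obtain ⟨M, v, hv⟩ := stub_tameScarZoom ν T u p H (hD ν T u p H hTame)
      (stub_violatorsApproachScar ν T u p H hTame hEnv)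
    exact noTameTwinScar' M v hv
  · intro hCrux ν T u p H _
    obtain ⟨hν, hT, hmax, hLH, hdec, hTI, hfin⟩ := H
    exact octaveBudget_of_envelope hT (hCrux ν T hν hT u p hmax hLH hdec hTI hfin)

end Summit.NavierStokesRegularity.NavierStokesRegularity.Cruxes.ScarEnvelopeTypeI.SliceBudget

end
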